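import Literature.Barriers.ABC.BakerMethodBounds
import Literature.NumberTheory.DiophantineGeometry.PastenSubexpTheorem14
import HarnessLib

/-!
# Proofs for `BakerMethodBounds`: Pasten's Theorem 1.4 (1) AND (2) from Theorems 2.1 and 2.5

`Literature/Barriers/ABC/BakerMethodBoundsSubexpProofs.lean` — second proofs companion of
`Literature/Barriers/ABC/BakerMethodBounds.lean` (proofs importing the barrier file).
H. Pasten, *The largest prime factor of `n² + 1` and improvements on subexponential `ABC`*,
Invent. Math. 236 (2024), Theorem 1.4 [cite: Pasten2024, Theorem 1.4]. (The first companion,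
`BakerMethodBoundsProofs.lean`, landed concurrently by another unit, deduces part (1) only and
conditionally on a THIRD fact, the exponential bound `stewartTijdeman1986_upperBound`; the present
file needs only the two facts below and also delivers part (2), the barrier file's
`pasten2024_thm_1_4_2`.)

Theorem 1.4 rests on two deep inputs, both vendored as named facts and both far outside Mathlib:
Theorem 2.1 (Evertse–Győry, Thm 4.2.1: linear forms in complex and `p`-adic logarithms, over `ℚ`,
`Literature.NumberTheory.DiophantineGeometry.Dioph.evertseGyory_thm_4_2_1_rat`) and Theorem 2.5
(the author's Shimura-curve bound `∏_{p ∣ abc} ν_p(abc) ≪_ε rad(abc)^{8/3+ε}`,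
`Literature.NumberTheory.DiophantineGeometry.pasten2024_thm_2_5`). This file proves the
DEDUCTION of Theorem 1.4 (1) and (2) from these two facts, i.e. §4 and §5 of the paper, with
absolute constant `κ = 12` resp. `13` and threshold `R₀ = exp L⋆(K, κ₁)`:
`pasten2024_thm_1_4_1_of`, `pasten2024_thm_1_4_2_of`. The undischarged trust base of
`pasten2024_thm_1_4_2` is therefore exactly `{evertseGyory_thm_4_2_1_rat, pasten2024_thm_2_5}`.
Relative to the printed proof: the a-priori exponential bound taken there from Stewart–Tijdeman
is re-derived from Theorem 2.1 (`Pasten.apriori_bound`), and the AM–GM/Lemma 3.1 step is replaced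
by the cruder `∏_{p ∈ I} log p ≤ (log R)^{#I}` (same shape of bound, larger `κ`).

## References

* [Pasten2024] H. Pasten, Invent. Math. 236 (2024), 373–385, doi:10.1007/s00222-024-01244-6,
  arXiv:2312.03566 — Theorem 1.4, §§4–5.
-/

noncomputable section

open Real
open Literature.NumberTheory.DiophantineGeometry
open Literature.NumberTheory.DiophantineGeometry.Dioph
open Literature.NumberTheory.DiophantineGeometry.Pasten

namespace Literature.Barriers.ABC

/-- A prime factor of `x` is at most `P(x)`. [folklore] -/
theorem le_largestPrimeFactor_of_mem_primeFactors {x p : ℕ} (hp : p ∈ x.primeFactors) :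
    p ≤ largestPrimeFactor x := by
  rw [largestPrimeFactor_def]
  exact le_trans (Finset.le_sup (f := id) hp) (le_max_right _ _)

/-- **The member `a`:** `log c ≤ P(a) · B^{13}` — by Theorem 1.4 (1) with `η = 1/2` if `a ≤ √c`,
and by the place `p₀ ∣ a` of maximal exponent otherwise (`p₀ ≤ P(a)`). [cite: Pasten2024, §5] -/
theorem log_le_largestPrimeFactor_mul {K κ : ℝ} (hK : 1 ≤ K) (hκ : 1 ≤ κ)
    (hP : PastenApproximationBound K) {a b c : ℕ} (h : IsABCTriple a b c)
    (hL : Lstar K κ ≤ Real.log (rad a b c : ℕ))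
    (hE : (exponentProduct (a * b * c) : ℝ) ≤ κ * (rad a b c : ℝ) ^ 3) :
    Real.log c ≤ largestPrimeFactor a * bfun (rad a b c : ℕ) ^ 13 := by
  obtain ⟨ha, hb, habc, hcop⟩ := id h
  set B : ℝ := bfun (rad a b c : ℕ) with hBdef
  have hB2 : 2 ≤ B := by
    rw [hBdef, bfun_def, sfun_def]
    linarith [le_exp_sqrt_mul_log_of_Lstar_le hL, large_le_of_Lstar_le hL]
  have hB0 : 0 ≤ B := by linarith
  have hq1 : (1 : ℝ) ≤ largestPrimeFactor a := by
    exact_mod_cast (le_max_left _ _ : 1 ≤ largestPrimeFactor a)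
  have hc : 0 < c := by omega
  have hc' : (0 : ℝ) < c := by exact_mod_cast hc
  by_cases hac : (a : ℝ) ≤ (c : ℝ) ^ (1 - 1 / 2 : ℝ)
  · have h1 := thm_1_4_1_core hK hκ hP h hL hE (by norm_num : (0 : ℝ) < 1 / 2) hac
    calc Real.log c ≤ 2 * B ^ 12 := by norm_num at h1 ⊢; exact h1.le
      _ ≤ B * B ^ 12 := mul_le_mul_of_nonneg_right hB2 (pow_nonneg hB0 12)
      _ = 1 * B ^ 13 := by ring
      _ ≤ largestPrimeFactor a * B ^ 13 :=
          mul_le_mul_of_nonneg_right hq1 (pow_nonneg hB0 13)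
  · push Not at hac
    have hya : Real.log c < 2 * Real.log a := by
      have := Real.log_lt_log (by positivity) hac
      rw [Real.log_rpow hc'] at this
      linarith
    have ha2 : 1 < a := by
      have hlogc : 0 < Real.log c :=
        Real.log_pos (by exact_mod_cast (show 1 < c by omega))
      have hloga : 0 < Real.log a := by linarith
      exact_mod_cast (Real.log_pos_iff (by exact_mod_cast ha.le)).mp hloga
    obtain ⟨p₀, hp₀, hmax⟩ := Finset.exists_max_image a.primeFactors
      (fun p => a.factorization p) (Nat.nonempty_primeFactors.mpr ha2)
    have h2 := case_two_a hK hκ hP h hL hE hya hp₀ hmax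
    calc Real.log c ≤ p₀ * B ^ 13 := h2.le
      _ ≤ largestPrimeFactor a * B ^ 13 := by
          apply mul_le_mul_of_nonneg_right _ (pow_nonneg hB0 13)
          exact_mod_cast le_largestPrimeFactor_of_mem_primeFactors hp₀

/-- **The member `c`:** `log c ≤ P(c) · B^{13}` by the place `p₀ ∣ c` of maximal exponent.
[cite: Pasten2024, §5] -/
theorem log_le_largestPrimeFactor_c_mul {K κ : ℝ} (hK : 1 ≤ K) (hκ : 1 ≤ κ)
    (hP : PastenApproximationBound K) {a b c : ℕ} (h : IsABCTriple a b c)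
    (hL : Lstar K κ ≤ Real.log (rad a b c : ℕ))
    (hE : (exponentProduct (a * b * c) : ℝ) ≤ κ * (rad a b c : ℝ) ^ 3) :
    Real.log c ≤ largestPrimeFactor c * bfun (rad a b c : ℕ) ^ 13 := by
  obtain ⟨ha, hb, habc, hcop⟩ := id h
  have hB0 : 0 ≤ bfun (rad a b c : ℕ) := (bfun_pos _).le
  -- the triple is not `1 + 1 = 2` (as `log rad ≥ L⋆`)
  have hab : 1 < a * b := by
    by_contra hle
    push Not at hle
    have ha1 : a = 1 := by nlinarith
    have hb1 : b = 1 := by nlinarith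
    subst ha1
    subst hb1
    have hc2 : c = 2 := by omega
    subst hc2
    have hle2 : rad 1 1 2 ≤ 2 := by
      rw [rad_def]; exact Nat.radical_le_self_iff.mpr (by norm_num)
    have hlog : Real.log (rad 1 1 2 : ℕ) ≤ Real.log 2 :=
      Real.log_le_log (by rw [rad_def]; exact_mod_cast Nat.radical_pos _) (by exact_mod_cast hle2)
    have hlog2 : Real.log 2 < 1 := by
      have := Real.log_two_lt_d9; linarith
    linarith [large_le_of_Lstar_le hL]
  obtain ⟨p₀, hp₀, hmax⟩ := Finset.exists_max_image c.primeFactors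
    (fun p => c.factorization p) (Nat.nonempty_primeFactors.mpr (by omega))
  have h2 := case_two_c hK hκ hP h hL hE hab hp₀ hmax
  calc Real.log c ≤ p₀ * bfun (rad a b c : ℕ) ^ 13 := h2.le
    _ ≤ largestPrimeFactor c * bfun (rad a b c : ℕ) ^ 13 := by
        apply mul_le_mul_of_nonneg_right _ (pow_nonneg hB0 13)
        exact_mod_cast le_largestPrimeFactor_of_mem_primeFactors hp₀

/-- The hypotheses of the core lemmas from the Shimura-curve fact: with `κ₁ = max κ 1` (`κ` from
Theorem 2.5 at `ε = 1/3`) and `R₀ = exp L⋆(K, κ₁)`, every abc triple with `rad(abc) ≥ R₀` has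
`log rad ≥ L⋆` and `∏ ν_p(abc) ≤ κ₁ rad³`. [cite: Pasten2024, §4] -/
theorem inputs_of_facts (K : ℝ) (hSh : pasten2024_thm_2_5) :
    ∃ κ₁ : ℝ, 1 ≤ κ₁ ∧ ∀ a b c : ℕ, IsABCTriple a b c →
      Real.exp (Lstar K κ₁) ≤ (rad a b c : ℝ) →
        Lstar K κ₁ ≤ Real.log (rad a b c : ℕ) ∧
        (exponentProduct (a * b * c) : ℝ) ≤ κ₁ * (rad a b c : ℝ) ^ 3 := by
  obtain ⟨κ, hκ⟩ := hSh (1 / 3) (by norm_num)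
  refine ⟨max κ 1, le_max_right _ _, fun a b c h hR => ⟨?_, ?_⟩⟩
  · have := Real.log_le_log (Real.exp_pos _) hR
    rwa [Real.log_exp] at this
  · have h1 := hκ a b c h
    have hR0 : (0 : ℝ) ≤ (rad a b c : ℝ) := Nat.cast_nonneg _
    have hR3 : (rad a b c : ℝ) ^ (8 / 3 + 1 / 3 : ℝ) = (rad a b c : ℝ) ^ 3 := by norm_num
    rw [hR3] at h1
    exact h1.trans (mul_le_mul_of_nonneg_right (le_max_left _ _) (pow_nonneg hR0 3))

/-- **Theorem 1.4 (1) from ANY approximation bound of Pasten's shape and Theorem 2.5:** if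
`PastenApproximationBound K` holds for some `K ≥ 1`, then `pasten2024_thm_1_4_1` holds with
`κ = 12` and `R₀ = exp L⋆(K, κ₁)`. [cite: Pasten2024, Theorem 1.4 (1)] -/
theorem pasten2024_thm_1_4_1_of_bounds {K : ℝ} (hK : 1 ≤ K) (hP : PastenApproximationBound K)
    (hSh : pasten2024_thm_2_5) : pasten2024_thm_1_4_1 := by
  obtain ⟨κ₁, hκ₁, hin⟩ := inputs_of_facts K hSh
  refine ⟨12, by norm_num, Real.exp (Lstar K κ₁), fun a b c h hR η hη hac => ?_⟩
  obtain ⟨hL, hE⟩ := hin a b c h hR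
  have := thm_1_4_1_core hK hκ₁ hP h hL hE hη hac
  rw [show (12 : ℝ) = ((12 : ℕ) : ℝ) by norm_num, ← sfun_def, ← bfun_pow]
  exact this.le

/-- **Theorem 1.4 (2) from ANY approximation bound of Pasten's shape and Theorem 2.5:** if
`PastenApproximationBound K` holds for some `K ≥ 1`, then `pasten2024_thm_1_4_2` holds with
`κ = 13` and `R₀ = exp L⋆(K, κ₁)`: `log c ≤ q · exp(13 √((log R) log₂ R))`,
`q = min{P(a), P(b), P(c)}`. The case `q = P(c)` uses the place `p₀ ∣ c` of maximal exponent with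
`ξ = −a/b`; the cases `q = P(a)`, `q = P(b)` use Theorem 1.4 (1) (`η = 1/2`) or the place
`p₀ ∣ a` (resp. `p₀ ∣ b`, by symmetry) of maximal exponent. [cite: Pasten2024, Theorem 1.4 (2)] -/
theorem pasten2024_thm_1_4_2_of_bounds {K : ℝ} (hK : 1 ≤ K) (hP : PastenApproximationBound K)
    (hSh : pasten2024_thm_2_5) : pasten2024_thm_1_4_2 := by
  obtain ⟨κ₁, hκ₁, hin⟩ := inputs_of_facts K hSh
  refine ⟨13, by norm_num, Real.exp (Lstar K κ₁), fun a b c h hR => ?_⟩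
  obtain ⟨hL, hE⟩ := hin a b c h hR
  rw [show (13 : ℝ) = ((13 : ℕ) : ℝ) by norm_num, ← sfun_def, ← bfun_pow]
  rcases min_choice (largestPrimeFactor a) (min (largestPrimeFactor b) (largestPrimeFactor c))
    with hqa | hqbc
  · rw [hqa]
    exact log_le_largestPrimeFactor_mul hK hκ₁ hP h hL hE
  · rw [hqbc]
    rcases min_choice (largestPrimeFactor b) (largestPrimeFactor c) with hqb | hqc
    · rw [hqb]
      have h' := h.swap
      have key := log_le_largestPrimeFactor_mul hK hκ₁ hP h' (by rwa [rad_swap])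
        (by rwa [rad_swap, show b * a * c = a * b * c by ring])
      rwa [rad_swap] at key
    · rw [hqc]
      exact log_le_largestPrimeFactor_c_mul hK hκ₁ hP h hL hE

/-- **Pasten 2024, Theorem 1.4 (1), from Evertse–Győry's Theorem 4.2.1 over `ℚ` (⟹ Theorem 2.1,
`K = pastenK`) and Theorem 2.5.** [cite: Pasten2024, Theorem 1.4 (1)] -/
theorem pasten2024_thm_1_4_1_of (hEG : evertseGyory_thm_4_2_1_rat) (hSh : pasten2024_thm_2_5) :
    pasten2024_thm_1_4_1 :=
  pasten2024_thm_1_4_1_of_bounds one_le_pastenK (pasten2024_thm_2_1 hEG) hSh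

/-- **Pasten 2024, Theorem 1.4 (2), from Evertse–Győry's Theorem 4.2.1 over `ℚ` (⟹ Theorem 2.1,
`K = pastenK`) and Theorem 2.5** — the conditional discharge of the barrier-file fact
`pasten2024_thm_1_4_2`; its trust base is exactly these two named facts.
[cite: Pasten2024, Theorem 1.4 (2)] -/
theorem pasten2024_thm_1_4_2_of (hEG : evertseGyory_thm_4_2_1_rat) (hSh : pasten2024_thm_2_5) :
    pasten2024_thm_1_4_2 :=
  pasten2024_thm_1_4_2_of_bounds one_le_pastenK (pasten2024_thm_2_1 hEG) hSh

end Literature.Barriers.ABC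

end
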